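import Mathlib
import HarnessLib

/-!
# Leibniz for POLY-FACTORIAL geometric jets: `‖Dⁱf‖ ≤ A·(i!)^a·ρⁱ`, `‖Dⁱg‖ ≤ B·(i!)^b·ρⁱ` ⇒ `‖Dⁿ(f·g)‖ ≤ A·B·(n!)^{max(a,b)}·(2ρ)ⁿ`

Topic `Analysis/Calculus`; companion of `IteratedDerivCompGeometric` (composition for geometric jets).  The crude composition bounds (Mathlib's
`norm_iteratedFDeriv_comp_le`, `…CompGeometric`) turn geometric-factorial jets `i!·ρⁱ` into `(i!)²·ρⁱ`, `(i!)³·ρⁱ`, …; to ASSEMBLE products of such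
factors (the K3 two-leg reading's dressing factors `(1 − κΨ̃)² − 1`, `−βL²κ²Ψ̃` and the single-scale defect `Ψ̃ − Ψ`, Benfatto–Giuliani–Mastropietro 2006
§2.2–2.3, cell gate-hubbard-kl memo SUP-ROUTE-SPEC §2(c)) one needs the class «`A·(i!)^a·ρⁱ`» to be closed under multiplication, with explicit constants.
Mathlib's Leibniz bound `norm_iteratedFDeriv_mul_le` gives it: `Σ_i C(n,i)·(i!)^a·((n−i)!)^b ≤ (n!)^{max(a,b)}·2ⁿ`.

* `factorial_pow_mul_factorial_pow_le` — `(i!)^a·((n−i)!)^b ≤ (n!)^{max a b}` (`i ≤ n`);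
* **`norm_iteratedFDeriv_mul_le_of_factorialPow`** — the product bound at a point, for functions with values in a normed `ℝ`-algebra.

Everything is proved; no definitions; no named facts.

## Sources

G. Benfatto, A. Giuliani, V. Mastropietro, Ann. Henri Poincaré 7 (2006) 809–898, §3 (3.2)–(3.8) (`BenfattoGiulianiMastropietro2006`); the Leibniz bound
is Mathlib's `norm_iteratedFDeriv_mul_le`.
-/

noncomputable section

namespace Literature.Analysis.Calculus

open Finset
open scoped Nat

/-- `(i!)^a·((n−i)!)^b ≤ (n!)^{max a b}` for `i ≤ n` (`i!·(n−i)! ≤ n!`, `k! ≥ 1`). [cite: BenfattoGiulianiMastropietro2006, §3 (3.2)] -/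
theorem factorial_pow_mul_factorial_pow_le {i n : ℕ} (a b : ℕ) (hin : i ≤ n) :
    ((i ! : ℝ)) ^ a * (((n - i) ! : ℝ)) ^ b ≤ ((n ! : ℝ)) ^ (max a b) := by
  have hprod : ((i ! : ℝ)) * ((n - i) ! : ℝ) ≤ n ! := by
    have h := Nat.le_of_dvd (Nat.factorial_pos _) (Nat.factorial_mul_factorial_dvd_factorial_add i (n - i))
    rw [Nat.add_sub_cancel' hin] at h
    exact_mod_cast h
  have hi1 : (1 : ℝ) ≤ i ! := by exact_mod_cast Nat.one_le_iff_ne_zero.2 (Nat.factorial_ne_zero i)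
  have hj1 : (1 : ℝ) ≤ (n - i) ! := by exact_mod_cast Nat.one_le_iff_ne_zero.2 (Nat.factorial_ne_zero (n - i))
  have hn1 : (1 : ℝ) ≤ n ! := by exact_mod_cast Nat.one_le_iff_ne_zero.2 (Nat.factorial_ne_zero n)
  set m := max a b with hm
  have ham : a ≤ m := le_max_left _ _
  have hbm : b ≤ m := le_max_right _ _
  calc ((i ! : ℝ)) ^ a * (((n - i) ! : ℝ)) ^ b ≤ ((i ! : ℝ)) ^ m * (((n - i) ! : ℝ)) ^ m :=
        mul_le_mul (pow_le_pow_right₀ hi1 ham) (pow_le_pow_right₀ hj1 hbm) (by positivity) (by positivity)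
    _ = (((i ! : ℝ)) * ((n - i) ! : ℝ)) ^ m := by rw [mul_pow]
    _ ≤ ((n ! : ℝ)) ^ m := pow_le_pow_left₀ (by positivity) hprod m

variable {E 𝔸 : Type*} [NormedAddCommGroup E] [NormedSpace ℝ E] [NormedRing 𝔸] [NormedAlgebra ℝ 𝔸]

/-- **Leibniz for poly-factorial geometric jets.**  If at `x`, for every `i ≤ n`, `‖Dⁱf(x)‖ ≤ A·(i!)^a·ρⁱ` and `‖Dⁱg(x)‖ ≤ B·(i!)^b·ρⁱ` (`0 ≤ A, B, ρ`),
then `‖Dⁿ(f·g)(x)‖ ≤ A·B·(n!)^{max a b}·(2ρ)ⁿ`. [cite: BenfattoGiulianiMastropietro2006, §3 (3.2)] -/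
theorem norm_iteratedFDeriv_mul_le_of_factorialPow {f g : E → 𝔸} {n : ℕ} {N : WithTop ℕ∞} (hf : ContDiff ℝ N f) (hg : ContDiff ℝ N g)
    (hn : (n : WithTop ℕ∞) ≤ N) (x : E) {A B ρ : ℝ} {a b : ℕ} (hA : 0 ≤ A) (hB : 0 ≤ B) (hρ : 0 ≤ ρ)
    (hfA : ∀ i ≤ n, ‖iteratedFDeriv ℝ i f x‖ ≤ A * ((i ! : ℝ)) ^ a * ρ ^ i) (hgB : ∀ i ≤ n, ‖iteratedFDeriv ℝ i g x‖ ≤ B * ((i ! : ℝ)) ^ b * ρ ^ i) :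
    ‖iteratedFDeriv ℝ n (fun y => f y * g y) x‖ ≤ A * B * ((n ! : ℝ)) ^ (max a b) * (2 * ρ) ^ n := by
  refine (norm_iteratedFDeriv_mul_le hf hg x hn).trans ?_
  have hterm : ∀ i ∈ range (n + 1), (n.choose i : ℝ) * ‖iteratedFDeriv ℝ i f x‖ * ‖iteratedFDeriv ℝ (n - i) g x‖ ≤
      A * B * ((n ! : ℝ)) ^ (max a b) * ρ ^ n * (n.choose i : ℝ) := by
    intro i hi
    have hin : i ≤ n := Nat.lt_succ_iff.1 (mem_range.1 hi)
    have h1 := hfA i hin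
    have h2 := hgB (n - i) (Nat.sub_le n i)
    have hfac := factorial_pow_mul_factorial_pow_le a b hin
    calc (n.choose i : ℝ) * ‖iteratedFDeriv ℝ i f x‖ * ‖iteratedFDeriv ℝ (n - i) g x‖
        ≤ (n.choose i : ℝ) * (A * ((i ! : ℝ)) ^ a * ρ ^ i) * (B * (((n - i) ! : ℝ)) ^ b * ρ ^ (n - i)) := by gcongr
      _ = A * B * (((i ! : ℝ)) ^ a * (((n - i) ! : ℝ)) ^ b) * (ρ ^ i * ρ ^ (n - i)) * (n.choose i : ℝ) := by ring
      _ = A * B * (((i ! : ℝ)) ^ a * (((n - i) ! : ℝ)) ^ b) * ρ ^ n * (n.choose i : ℝ) := by rw [← pow_add, Nat.add_sub_cancel' hin]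
      _ ≤ A * B * ((n ! : ℝ)) ^ (max a b) * ρ ^ n * (n.choose i : ℝ) := by gcongr
  refine (sum_le_sum hterm).trans (le_of_eq ?_)
  rw [← mul_sum]
  have hsum : ∑ i ∈ range (n + 1), (n.choose i : ℝ) = 2 ^ n := by exact_mod_cast Nat.sum_range_choose n
  rw [hsum, mul_pow]
  ring

end Literature.Analysis.Calculus

end
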